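import Summits.HodgeConjecture.CorCM.DihedralReflexPairCMHodge
import Summits.HodgeConjecture.CorCM.ImaginaryQuadraticsTimesConjSquareCMHodge
import Summits.HodgeConjecture.CorCM.QuadraticCMFamiliesHodge
import Summits.HodgeConjecture.CorCM.QuadraticCMFamiliesNonisogenous
import HarnessLib

/-!
# CM elliptic curves times the mixed dihedral pair: the Hodge conjecture for every
# `E_1^{a_1} × ⋯ × E_r^{a_r} × S^c × S′^d`

COR-CM (cell `pub-hodgecm2`, seat p2 gen 18, count-neutral claim CLOSURE-BOUND (F5)); NEW as stated, hence under `Summits/`.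
Theorems only; no definition, no named fact, no `sorry`.  Sequel of `DihedralReflexPairCMHodge` (F4b: two simple CM
abelian surfaces `S, S′` with NON-ISOMORPHIC non-Galois quartic CM fields `K, M` sharing their dihedral octic Galois closure
form a nondegenerate pair) and of `ImaginaryQuadraticsTimesConjSquareCMHodge` (seat p2 gen 17: block partial conjugations
`τ²`).

THE MECHANISM.  Let `τ ∈ Aut(ℂ)` be Shimura's `4`-cycle of `K` (`QuarticCM.exists_ringAut_smul_smul_eq_conjugate`:
`τ ∘ τ ∘ s = s̄` on `Hom(K, ℂ)`).  Then `τ²` is complex conjugation on the Galois closure `L` of `K`, hence on `Hom(M, ℂ)`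
(`DihedralReflexPair.smul_eq_smul_of_forall_smul_eq`: the embeddings of `M` land in `L`), and the square of ANY automorphism
of `ℂ` is the identity on the two embeddings of an imaginary quadratic field (`QuarticCM.smul_smul_eq_self_of_finrank_eq_two`).
So `τ²` is a (pointwise) BLOCK PARTIAL CONJUGATION for the block `B = {S, S′}` of a family
`(E_1, …, E_r, S, S′)`, and nondegeneracy splits (`isNondegenerateFamily_iff_of_block`): the block `{S, S′}` is nondegenerate
by F4b, the block of curves iff it is separating (`isNondegenerateFamily_iff_isSeparatingFamily_of_finrank_eq_two`, seat
lit-deligne-3 / `QuadraticCMFamiliesHodge`), i.e. iff the curves are pairwise non-isogenous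
(`isSeparatingFamily_iff_pairwise_not_isIsogenous`, seat b16).  NOTHING is asked between the curves and the surfaces: every
imaginary quadratic field meets the dihedral octic `L` trivially anyway (its quadratic subfields are real), but the block
argument does not even need this.

WHAT IS PROVED.
* **`isNondegenerateFamily_curves_dihedralReflexPair`** — types: block `B = {i₀, i₁}` as in F4b (non-Galois quartic CM
  fields, `Hom(K_{i₁}, ℂ) ⊆ L_{K_{i₀}}`, `Hom(K_{i₁}, K_{i₀}) = ∅`), imaginary quadratic slots off `B` forming a separating
  family ⟹ `CMAlgebra.IsNondegenerateFamily Φ` (for ALL types on the block).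
* **`hodgeConjectureFor_prod_curves_dihedralReflexPair`**, `hodgeClassSpan_prod_eq_divisorClassesSpan_curves_dihedralReflexPair`
  — `B• = D•` and the Hodge conjecture on every `⨁_{k<N} A_{π k}` = every `E_1^{a_1} × ⋯ × E_r^{a_r} × S^c × S′^d`, UNCONDITIONAL;
  **`hodgeConjectureFor_prod_curves_dihedralReflexPair_of_not_isIsogenous`** — the same with the curves given as pairwise
  NON-ISOGENOUS CM elliptic curves (Moonen–Zarhin (3.9) wording).

## References

* [MoonenZarhin1999LowDim] B. Moonen, Yu. Zarhin, *Hodge classes on abelian varieties of low dimension*, Math. Ann. 315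
  (1999) 711–733, "Hodge groups of simple abelian surfaces of CM-type" and Cor. (3.9).
* [Gordon1999HodgeAVSurvey] B. B. Gordon, *A survey of the Hodge conjecture for abelian varieties*, §3 (Imai–Murty), 7.5,
  10.10.
* [Shimura1998] G. Shimura, *Abelian Varieties with Complex Multiplication and Modular Functions*, §8.4 Example (2)(C).
-/

noncomputable section

open CategoryTheory CategoryTheory.Limits NumberField NumberField.ComplexEmbedding IntermediateField
open scoped BigOperators

namespace Summit.HodgeConjecture.CorCM

open Literature.NumberTheory.ComplexMultiplication
open Literature.AlgebraicGeometry.Motives (AbelianVariety CMType)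
open Literature.AlgebraicGeometry.HodgeTheory
open Literature.AlgebraicGeometry.ComplexMultiplication (IsCMTypeRealisation)
open Literature.AlgebraicGeometry.VanGeemen1994 (hodgeClassSpan)
open Literature.AlgebraicGeometry.Pohlmann1968
open Literature.Barriers.HodgeConjecture (divisorClassesSpan)
open QuarticCM

section Types

variable {I : Type} {K : I → Type} [∀ i, Field (K i)] [∀ i, NumberField (K i)] [∀ i, IsCMField (K i)] [Fintype I]
  [DecidableEq I]

omit [Fintype I] [DecidableEq I] in
/-- **`τ²` is a block partial conjugation for the dihedral block.**  With `τ` the `4`-cycle of `K_{i₀}` (`τ ∘ τ ∘ s = s̄` on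
`Hom(K_{i₀}, ℂ)`): `τ²` is complex conjugation on `Hom(K_{i₁}, ℂ)` too (these embeddings land in the Galois closure of
`K_{i₀}`, on which `τ² = ρ`) and the identity on the embeddings of every imaginary quadratic slot.
[cite: Gordon1999HodgeAVSurvey, §3 Theorem (proof)] -/
theorem exists_blockConj_curves_dihedralReflexPair (p : I → Prop) {i₀ i₁ : I} (hpI : ∀ i, p i ↔ i = i₀ ∨ i = i₁)
    (h2 : ∀ j, ¬p j → Module.finrank ℚ (K j) = 2) (h4₀ : Module.finrank ℚ (K i₀) = 4) (hK₀ : ¬IsGalois ℚ (K i₀))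
    (hMK : ∀ (t : K i₁ →+* ℂ) (y : K i₁), t y ∈ normalClosure ℚ (K i₀) ℂ) :
    ∃ σ : ℂ ≃+* ℂ, (∀ i, p i → ∀ s : K i →+* ℂ, σ • s = conjugate s) ∧ ∀ i, ¬p i → ∀ s : K i →+* ℂ, σ • s = s := by
  obtain ⟨τ, hτ⟩ := exists_ringAut_smul_smul_eq_conjugate h4₀ hK₀
  have hK' : ∀ s : K i₀ →+* ℂ, (τ * τ) • s = (starRingAut : ℂ ≃+* ℂ) • s := fun s => by
    rw [mul_smul, hτ, conj_smul_eq_conjugate]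
  refine ⟨τ * τ, fun i hi s => ?_, fun i hi s => ?_⟩
  · rcases (hpI i).1 hi with rfl | rfl
    · rw [mul_smul, hτ]
    · rw [DihedralReflexPair.smul_eq_smul_of_forall_smul_eq hMK hK' s, conj_smul_eq_conjugate]
  · rw [mul_smul, smul_smul_eq_self_of_finrank_eq_two (h2 i hi) τ s]

/-- **Nondegeneracy of `(E_1, …, E_r, S, S′)`.**  Block `B = {i₀, i₁}`: NON-GALOIS quartic CM fields `K_{i₀}, K_{i₁}` with
`Hom(K_{i₁}, ℂ)` landing in the Galois closure of `K_{i₀}` and `Hom(K_{i₁}, K_{i₀}) = ∅` (the two quartic CM classes of one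
dihedral octic field); off `B`: imaginary quadratic fields whose types form a SEPARATING family.  Then the whole family is
nondegenerate, whatever the types on the block (`τ²`-splitting; F4b on the block; Artin independence of the sign
characters off the block). [cite: MoonenZarhin1999LowDim, "Hodge groups of simple abelian surfaces of CM-type" and Cor. (3.9)]
[cite: Gordon1999HodgeAVSurvey, §3 Theorem and 7.5] -/
theorem isNondegenerateFamily_curves_dihedralReflexPair (p : I → Prop) [DecidablePred p] {i₀ i₁ : I}
    (hpI : ∀ i, p i ↔ i = i₀ ∨ i = i₁) (h01 : i₀ ≠ i₁) (h2 : ∀ j, ¬p j → Module.finrank ℚ (K j) = 2)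
    (h4₀ : Module.finrank ℚ (K i₀) = 4) (hK₀ : ¬IsGalois ℚ (K i₀)) (h4₁ : Module.finrank ℚ (K i₁) = 4)
    (hK₁ : ¬IsGalois ℚ (K i₁)) (hMK : ∀ (t : K i₁ →+* ℂ) (y : K i₁), t y ∈ normalClosure ℚ (K i₀) ℂ)
    (hne : IsEmpty (K i₁ →+* K i₀)) (Φ : ∀ i, CMType (K i))
    (hsep : CMAlgebra.IsSeparatingFamily (fun j : {j // ¬p j} => Φ j.1)) : CMAlgebra.IsNondegenerateFamily Φ := by
  have hp0 : p i₀ := (hpI i₀).2 (Or.inl rfl)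
  have hp1 : p i₁ := (hpI i₁).2 (Or.inr rfl)
  by_cases hnp : ∃ j, ¬p j
  · obtain ⟨σ, hσ, hσ'⟩ := exists_blockConj_curves_dihedralReflexPair p hpI h2 h4₀ hK₀ hMK
    rw [isNondegenerateFamily_iff_of_block p hσ hσ' ⟨i₀, hp0⟩ hnp Φ]
    constructor
    · -- the block `{i₀, i₁}`: the mixed dihedral pair
      have hI' : ∀ j : {i // p i}, j = ⟨i₀, hp0⟩ ∨ j = ⟨i₁, hp1⟩ := fun j => by
        rcases (hpI j.1).1 j.2 with h | h
        · exact Or.inl (Subtype.ext h)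
        · exact Or.inr (Subtype.ext h)
      have h01' : (⟨i₀, hp0⟩ : {i // p i}) ≠ ⟨i₁, hp1⟩ := fun h => h01 (congrArg Subtype.val h)
      exact DihedralReflexPair.isNondegenerateFamily_of_dihedralReflexPair (K := fun i : {i // p i} => K i.1) hI' h01'
        h4₀ hK₀ h4₁ hK₁ hMK hne (fun i => Φ i.1)
    · -- the quadratic block
      obtain ⟨j₀, hj₀⟩ := hnp
      haveI : Nonempty {j // ¬p j} := ⟨⟨j₀, hj₀⟩⟩
      exact isNondegenerateFamily_of_finrank_eq_two (fun j : {j // ¬p j} => h2 j.1 j.2) hsep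
  · -- no quadratic slot: the family IS the pair
    push Not at hnp
    have hI : ∀ j, j = i₀ ∨ j = i₁ := fun j => (hpI j).1 (hnp j)
    exact DihedralReflexPair.isNondegenerateFamily_of_dihedralReflexPair hI h01 h4₀ hK₀ h4₁ hK₁ hMK hne Φ

end Types

/-! ### Geometry -/

section Geometry

variable {I : Type} {K : I → Type} [∀ i, Field (K i)] [∀ i, NumberField (K i)] [∀ i, IsCMField (K i)] [Fintype I]
  [DecidableEq I] [Nonempty I] {Φ : ∀ i, CMType (K i)}
variable {A : I → AbelianVariety ℂ} {ι : ∀ i, 𝓞 (K i) →+* End (A i)}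
  {θ : ∀ i, K i →+* Module.End ℂ (complexBetti (A i).X 1)}

/-- **`B• = D•` on every `E_1^{a_1} × ⋯ × E_r^{a_r} × S^c × S′^d`**: the `E_j` realisations of a separating family of
imaginary quadratic types (pairwise non-isogenous CM elliptic curves), `S, S′` realisations of types of the two quartic CM
classes `K_{i₀} ≇ K_{i₁}` of one dihedral octic field. [cite: Gordon1999HodgeAVSurvey, 7.5 and 10.10]
[cite: MoonenZarhin1999LowDim, "Hodge groups of simple abelian surfaces of CM-type" and Cor. (3.9)] -/
theorem hodgeClassSpan_prod_eq_divisorClassesSpan_curves_dihedralReflexPair (p : I → Prop) [DecidablePred p]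
    {i₀ i₁ : I} (hpI : ∀ i, p i ↔ i = i₀ ∨ i = i₁) (h01 : i₀ ≠ i₁) (h2 : ∀ j, ¬p j → Module.finrank ℚ (K j) = 2)
    (h4₀ : Module.finrank ℚ (K i₀) = 4) (hK₀ : ¬IsGalois ℚ (K i₀)) (h4₁ : Module.finrank ℚ (K i₁) = 4)
    (hK₁ : ¬IsGalois ℚ (K i₁)) (hMK : ∀ (t : K i₁ →+* ℂ) (y : K i₁), t y ∈ normalClosure ℚ (K i₀) ℂ)
    (hne : IsEmpty (K i₁ →+* K i₀)) (hsep : CMAlgebra.IsSeparatingFamily (fun j : {j // ¬p j} => Φ j.1))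
    (hA : ∀ i, IsCMTypeRealisation (Φ i) (A i) (ι i) (θ i)) {N : ℕ} (π : Fin N → I) (m : ℕ) :
    hodgeClassSpan (⨁ fun j : Fin N => A (π j)).dim (⨁ fun j : Fin N => A (π j)).X m =
      divisorClassesSpan (⨁ fun j : Fin N => A (π j)).X (⨁ fun j : Fin N => A (π j)).dim m :=
  (isNondegenerateFamily_curves_dihedralReflexPair p hpI h01 h2 h4₀ hK₀ h4₁ hK₁ hMK hne Φ
    hsep).hodgeClassSpan_prod_eq_divisorClassesSpan hA π m

/-- **The Hodge conjecture for every `E_1^{a_1} × ⋯ × E_r^{a_r} × S^c × S′^d`** (every `⨁_{k<N} A_{π k}`): `E_j` realisations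
of a SEPARATING family of imaginary quadratic CM types, `S, S′` simple CM abelian surfaces realising types of the two
NON-ISOMORPHIC non-Galois quartic CM classes `K_{i₀}, K_{i₁}` of one dihedral octic Galois closure (`Hom(K_{i₁}, ℂ)` inside
the closure of `K_{i₀}`, `Hom(K_{i₁}, K_{i₀}) = ∅`) — UNCONDITIONAL, no named fact, no condition between curves and surfaces.
[cite: Gordon1999HodgeAVSurvey, §3 Theorem and 10.10] [cite: MoonenZarhin1999LowDim, "Hodge groups of simple abelian surfaces of CM-type" and Cor. (3.9)] -/
theorem hodgeConjectureFor_prod_curves_dihedralReflexPair (p : I → Prop) [DecidablePred p] {i₀ i₁ : I}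
    (hpI : ∀ i, p i ↔ i = i₀ ∨ i = i₁) (h01 : i₀ ≠ i₁) (h2 : ∀ j, ¬p j → Module.finrank ℚ (K j) = 2)
    (h4₀ : Module.finrank ℚ (K i₀) = 4) (hK₀ : ¬IsGalois ℚ (K i₀)) (h4₁ : Module.finrank ℚ (K i₁) = 4)
    (hK₁ : ¬IsGalois ℚ (K i₁)) (hMK : ∀ (t : K i₁ →+* ℂ) (y : K i₁), t y ∈ normalClosure ℚ (K i₀) ℂ)
    (hne : IsEmpty (K i₁ →+* K i₀)) (hsep : CMAlgebra.IsSeparatingFamily (fun j : {j // ¬p j} => Φ j.1))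
    (hA : ∀ i, IsCMTypeRealisation (Φ i) (A i) (ι i) (θ i)) {N : ℕ} (π : Fin N → I) :
    HodgeConjectureFor (⨁ fun j : Fin N => A (π j)).dim (⨁ fun j : Fin N => A (π j)).X :=
  (isNondegenerateFamily_curves_dihedralReflexPair p hpI h01 h2 h4₀ hK₀ h4₁ hK₁ hMK hne Φ
    hsep).hodgeConjectureFor_prod hA π

/-- The same with the curves given as PAIRWISE NON-ISOGENOUS CM elliptic curves (the `A_j`, `j ∉ B`, of dimension `1`,
realisations of imaginary quadratic types: Moonen–Zarhin (3.9) wording; seat b16's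
`isSeparatingFamily_iff_pairwise_not_isIsogenous`). [cite: MoonenZarhin1999LowDim, Cor. (3.9)]
[cite: Gordon1999HodgeAVSurvey, §3 Theorem and 10.10] -/
theorem hodgeConjectureFor_prod_curves_dihedralReflexPair_of_not_isIsogenous (p : I → Prop) [DecidablePred p]
    {i₀ i₁ : I} (hpI : ∀ i, p i ↔ i = i₀ ∨ i = i₁) (h01 : i₀ ≠ i₁) (h2 : ∀ j, ¬p j → Module.finrank ℚ (K j) = 2)
    (h4₀ : Module.finrank ℚ (K i₀) = 4) (hK₀ : ¬IsGalois ℚ (K i₀)) (h4₁ : Module.finrank ℚ (K i₁) = 4)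
    (hK₁ : ¬IsGalois ℚ (K i₁)) (hMK : ∀ (t : K i₁ →+* ℂ) (y : K i₁), t y ∈ normalClosure ℚ (K i₀) ℂ)
    (hne : IsEmpty (K i₁ →+* K i₀)) (hA : ∀ i, IsCMTypeRealisation (Φ i) (A i) (ι i) (θ i))
    (hni : ∀ i j, ¬p i → ¬p j → i ≠ j → ¬AbelianVariety.IsIsogenous (A i) (A j)) {N : ℕ} (π : Fin N → I) :
    HodgeConjectureFor (⨁ fun j : Fin N => A (π j)).dim (⨁ fun j : Fin N => A (π j)).X :=
  hodgeConjectureFor_prod_curves_dihedralReflexPair p hpI h01 h2 h4₀ hK₀ h4₁ hK₁ hMK hne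
    ((isSeparatingFamily_iff_pairwise_not_isIsogenous (Φ := fun j : {j // ¬p j} => Φ j.1) (fun j => h2 j.1 j.2)
        fun j => hA j.1).2 fun i j hij => hni i.1 j.1 i.2 j.2 fun h => hij (Subtype.ext h))
    hA π

end Geometry

end Summit.HodgeConjecture.CorCM

end
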